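import Literature.AnabelianGeometry.EtaleTheta.EtaleThetaClass
import Literature.AnabelianGeometry.EtaleTheta.Discharge.Sec2DeltaThetaTorsionFree
import Mathlib.NumberTheory.Padics.Hensel
import Mathlib.NumberTheory.Padics.RingHoms
import Mathlib.FieldTheory.Finite.Basic
import HarnessLib

/-!
# `KummerData` forces a NON-SIGN action of `(Π^tp_Y)^Θ` on `Δ_Θ` (every `ThetaSetting`, `p ≥ 5`)

Mochizuki, *The étale theta function …*, Publ. RIMS **45** (2009) [EtTh], §1, Prop. 1.5, PRIMS PDF pp. 22–23
[cite: MochizukiEtTh2009, Prop 1.5 p.23]: «`F² = H¹(G_K, Δ_Θ) ⥲ H¹(G_K, Ẑ(1)) ⥲ (K^×)^∧`» — the cell's §1 interface records the Kummer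
embedding `K^× ↪ (K^×)^∧ ↪ H¹((Π^tp_Y)^Θ, Δ_Θ)` as the DATA `ThetaSetting.KummerData` (abc-iut-L2-t1, `EtaleThetaClass.lean`:
injective `toKHat`, `kumY`). Cell abc-iut, layer L2 (NV lane), seat abc-iut-L2-t5 (gen 7), sequel to row R291 / verdict memo
R291-VERDICT.md Claim 1 and to abc-iut-w5-d171's `SettingModelKummerDataEmpty` («trivial action ⇒ no `2`-torsion ⇒ no
KummerData», p41xxxx) — generalised here from the TRIVIAL action to SIGN actions and from exponent `2` to every exponent.
PROOF-ONLY (0 definitions).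

RESULTS.
* §1 `ContH1.pow_two_eq_one_of_pow_eq_one_of_conj_sign` (generic continuous `H¹`): if every `h ∈ H` acts on the commutative,
  TORSION-FREE coefficients `A` either trivially or by inversion, then every torsion class of `H¹(H, A)` is `2`-torsion
  (`xⁿ = 1`, `n ≠ 0` ⇒ `x² = 1`; ⇒ `x = 1` for odd `n`). Proof: a cocycle `f` with `fⁿ = ∂a` vanishes on the elements acting
  trivially (there `∂a = 1` and `A` is torsion-free), hence is `1` on the index-`≤ 2` kernel and CONSTANT `= t := f(g)` on its
  complement, and `f² = ∂(t⁻¹)`.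
* §2 `ThetaSetting.h1Theta_pow_two_eq_one_of_conj_sign`, **`ThetaSetting.isEmpty_kummerData_of_conj_sign`**: for `D` with the
  guard `IsEtThOrigin` (`Δ_Θ` torsion-free, abc-iut-L2-t8/L2-t10 `deltaTheta_torsionfree`), if `(Π^tp_Y)^Θ` acts on `Δ_Θ` through
  `{±1}` and `K^×` has an element `u` with `uⁿ = 1`, `u² ≠ 1`, then `D` carries NO `KummerData`; contrapositive
  **`ThetaSetting.exists_conj_not_sign_of_kummerData`**: Kummer data force some `g ∈ (Π^tp_Y)^Θ` acting on `Δ_Θ` NEITHER trivially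
  NOR by inversion.
* §3 `padicInt_exists_pow_pred_eq_one_sq_ne_one` (Hensel, Gouvêa Prop. 4.6.1: a primitive `(p−1)`-th root of unity in `ℤ_p`;
  here: some `ζ ∈ ℤ_p` with `ζ^{p−1} = 1`, `ζ² ≠ 1`, for `p ≥ 5`), `ThetaSetting.exists_unit_pow_eq_one_sq_ne_one` (the same in
  `K^×`, `ℚ_p ⊆ K`), and the unconditional form for `p ≥ 5`: **`ThetaSetting.exists_conj_not_sign_of_kummerData_of_five_le`**.

READING (numbers, not taste; abc-iut-L2-lead G-row G-L2t5-1): at EVERY Kummer-carrying `ThetaSetting` with `p ≥ 5` the action of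
`(Π^tp_Y)^Θ` on `Δ_Θ ≅ Ẑ` contains an element acting by some `u ∉ {±1}` — so a «{±1}-twisted» carrier (the only commutator-axis
twist constructible from the tree's toolkit, R291-VERDICT Claim 3) is never Kummer-carrying for `p ≥ 5`, and a Kummer-carrying
commutator-axis carrier contains a `u`-scaling automorphism of the cusp axis with `u ∉ {±1}` (datum G-L2t5-1). Classical group
cohomology + Hensel under OUR kernel check; nothing of [EtTh] asserted; no side taken on [IUTchIII] Cor. 3.12; typed ≠ proved.
-/

noncomputable section

namespace Literature.AnabelianGeometry.EtaleTheta

open scoped IsMulCommutative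

/-! ## §1. Sign actions: torsion classes of `H¹` are `2`-torsion -/

namespace ContH1

variable {G G' : Type*} [Group G] [TopologicalSpace G]
  [Group G'] [TopologicalSpace G'] [IsTopologicalGroup G']
  {φ : G →* G'} {A : Subgroup G'} [A.Normal] [IsMulCommutative A] {H : Subgroup G}

omit [TopologicalSpace G] [TopologicalSpace G'] [IsTopologicalGroup G'] in
/-- If `h` acts on `A` by inversion then so does `h⁻¹`. [cite: NeukirchSchmidtWingberg2008, I §2] -/
theorem conjNormal_inv_eq_inv_of_conjNormal_eq_inv {h : G} (hinv : ∀ a : A, MulAut.conjNormal (φ h) a = a⁻¹) (a : A) :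
    MulAut.conjNormal (φ h⁻¹) a = a⁻¹ := by
  have h1 : MulAut.conjNormal (φ h) (MulAut.conjNormal (φ h⁻¹) a) = a := by
    rw [← MulAut.mul_apply, ← map_mul, ← map_mul, mul_inv_cancel, map_one, map_one, MulAut.one_apply]
  rw [hinv] at h1
  rw [← inv_inv (MulAut.conjNormal (φ h⁻¹) a), h1]

/-- **Sign actions: a cocycle whose class is torsion vanishes on the elements acting trivially** (there the coboundary
`∂a` vanishes and `A` is torsion-free). [cite: NeukirchSchmidtWingberg2008, I §2] -/
theorem apply_eq_one_of_pow_mem_coboundaries (hA : ∀ (a : A) (n : ℕ), n ≠ 0 → a ^ n = 1 → a = 1)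
    {f : contCocycles φ A H} {n : ℕ} (hn : n ≠ 0) (hfn : (f ^ n).1 ∈ contCoboundaries φ A H)
    (h : H) (htriv : ∀ a : A, MulAut.conjNormal (φ (h : G)) a = a) : f.1 h = 1 := by
  obtain ⟨a, ha⟩ := (mem_contCoboundaries_iff _).mp hfn
  have h1 := congrFun ha h
  rw [htriv a, mul_inv_cancel] at h1
  have h2 : f.1 h ^ n = 1 := by simpa using h1
  exact hA _ n hn h2

/-- **Sign actions have `2`-torsion `H¹`-torsion.** If every `h ∈ H` acts on the commutative, torsion-free `A` (through `φ`,
by conjugation) either trivially or by inversion, then every `x ∈ H¹(H, A)` with `xⁿ = 1`, `n ≠ 0`, satisfies `x² = 1`.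
[cite: NeukirchSchmidtWingberg2008, I §2] -/
theorem pow_two_eq_one_of_pow_eq_one_of_conj_sign
    (hsign : ∀ h : H, (∀ a : A, MulAut.conjNormal (φ (h : G)) a = a) ∨ (∀ a : A, MulAut.conjNormal (φ (h : G)) a = a⁻¹))
    (hA : ∀ (a : A) (n : ℕ), n ≠ 0 → a ^ n = 1 → a = 1)
    (x : ContH1 φ A H) {n : ℕ} (hn : n ≠ 0) (hx : x ^ n = 1) : x ^ 2 = 1 := by
  induction x using QuotientGroup.induction_on with
  | H f =>
    have hfn : f ^ n ∈ (contCoboundaries φ A H).subgroupOf (contCocycles φ A H) := by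
      rw [← QuotientGroup.eq_one_iff]
      exact hx
    rw [Subgroup.mem_subgroupOf] at hfn
    have hker : ∀ h : H, (∀ a : A, MulAut.conjNormal (φ (h : G)) a = a) → f.1 h = 1 :=
      fun h htriv => apply_eq_one_of_pow_mem_coboundaries hA hn hfn h htriv
    suffices hgoal : (f ^ 2).1 ∈ contCoboundaries φ A H by
      exact (QuotientGroup.eq_one_iff (f ^ 2)).mpr (Subgroup.mem_subgroupOf.mpr hgoal)
    rw [mem_contCoboundaries_iff]
    by_cases hall : ∀ h : H, ∀ a : A, MulAut.conjNormal (φ (h : G)) a = a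
    · -- trivial action: `f = 1`
      refine ⟨1, funext fun h => ?_⟩
      rw [Subgroup.coe_pow, Pi.pow_apply, hker h (hall h), one_pow, map_one, inv_one, mul_one]
    · -- an inverting element `g`; `f = t` off the kernel, `f² = ∂(t⁻¹)`
      push Not at hall
      obtain ⟨g, b, hb⟩ := hall
      have hginv : ∀ a : A, MulAut.conjNormal (φ (g : G)) a = a⁻¹ := by
        rcases hsign g with h | h
        · exact absurd (h b) hb
        · exact h
      set t : A := f.1 g with ht
      have hoff : ∀ h : H, (∀ a : A, MulAut.conjNormal (φ (h : G)) a = a⁻¹) → f.1 h = t := by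
        intro h hinv
        -- `k := g⁻¹ h` acts trivially, so `f k = 1` and `f h = f (g k) = f g · g(f k) = t`
        have hk : ∀ a : A, MulAut.conjNormal (φ ((g⁻¹ * h : H) : G)) a = a := by
          intro a
          rw [Subgroup.coe_mul, Subgroup.coe_inv, map_mul, map_mul, MulAut.mul_apply, hinv,
            conjNormal_inv_eq_inv_of_conjNormal_eq_inv hginv, inv_inv]
        have hfk : f.1 (g⁻¹ * h) = 1 := hker _ hk
        have hcoc := f.2.2 g (g⁻¹ * h)
        rw [mul_inv_cancel_left, hfk, map_one, mul_one] at hcoc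
        exact hcoc
      refine ⟨t⁻¹, funext fun h => ?_⟩
      rw [Subgroup.coe_pow, Pi.pow_apply, sq]
      rcases hsign h with htr | hinv
      · rw [hker h htr, htr, mul_inv_cancel, mul_one]
      · rw [hoff h hinv, hinv, inv_inv]

/-- … hence torsion classes of ODD order are trivial. [cite: NeukirchSchmidtWingberg2008, I §2] -/
theorem eq_one_of_pow_eq_one_of_conj_sign_of_odd
    (hsign : ∀ h : H, (∀ a : A, MulAut.conjNormal (φ (h : G)) a = a) ∨ (∀ a : A, MulAut.conjNormal (φ (h : G)) a = a⁻¹))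
    (hA : ∀ (a : A) (n : ℕ), n ≠ 0 → a ^ n = 1 → a = 1)
    (x : ContH1 φ A H) {n : ℕ} (hodd : Odd n) (hx : x ^ n = 1) : x = 1 := by
  obtain ⟨k, rfl⟩ := hodd
  have h2 := pow_two_eq_one_of_pow_eq_one_of_conj_sign hsign hA x (by omega) hx
  rw [pow_succ, pow_mul, h2, one_pow, one_mul] at hx
  exact hx

end ContH1

/-! ## §2. At a `ThetaSetting`: sign actions on `Δ_Θ` carry no `KummerData` -/

namespace ThetaSetting

variable {p : ℕ} [Fact p.Prime] (D : ThetaSetting p)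

/-- **Sign actions on `Δ_Θ` have `2`-torsion `H¹`-torsion** (`Δ_Θ` torsion-free under the guard). For `H' ≤ (Π^tp_X)^Θ` whose every
element centralises or inverts `Δ_Θ`: `cⁿ = 1`, `n ≠ 0` ⇒ `c² = 1` in `H¹(H', Δ_Θ)`. [cite: MochizukiEtTh2009, Prop 1.5 p.23] -/
theorem h1Theta_pow_two_eq_one_of_conj_sign (hO : D.IsEtThOrigin) (H' : Subgroup D.GtpTheta)
    (hsign : ∀ g ∈ H', (∀ a ∈ D.DeltaTheta, g * a * g⁻¹ = a) ∨ (∀ a ∈ D.DeltaTheta, g * a * g⁻¹ = a⁻¹))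
    (c : D.H1Theta H') {n : ℕ} (hn : n ≠ 0) (hc : c ^ n = 1) : c ^ 2 = 1 := by
  refine ContH1.pow_two_eq_one_of_pow_eq_one_of_conj_sign (fun h => ?_) (fun a m hm ha => ?_) c hn hc
  · rcases hsign h.1 h.2 with htr | hinv
    · exact Or.inl fun a => Subtype.ext (by rw [MulAut.conjNormal_apply, MonoidHom.id_apply]; exact htr a.1 a.2)
    · exact Or.inr fun a => Subtype.ext (by
        rw [MulAut.conjNormal_apply, MonoidHom.id_apply, Subgroup.coe_inv]; exact hinv a.1 a.2)
  · apply Subtype.ext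
    have hm' : (a : D.GtpTheta) ^ m = 1 := by
      have := congrArg Subtype.val ha
      simpa using this
    exact D.deltaTheta_torsionfree hO a.2 hm hm'

/-- **A theta setting whose `(Π^tp_Y)^Θ` acts on `Δ_Θ` through `{±1}` carries NO Kummer data** as soon as `K^×` has an element `u`
with `uⁿ = 1` (`n ≠ 0`) and `u² ≠ 1`: `u` would inject through `toKHat ≫ kumY` to an `n`-torsion, non-`2`-torsion class of
`H¹((Π^tp_Y)^Θ, Δ_Θ)`. [cite: MochizukiEtTh2009, Prop 1.5 p.23] -/
theorem isEmpty_kummerData_of_conj_sign (hO : D.IsEtThOrigin)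
    (hsign : ∀ g ∈ D.GtpY.map D.toTheta,
      (∀ a ∈ D.DeltaTheta, g * a * g⁻¹ = a) ∨ (∀ a ∈ D.DeltaTheta, g * a * g⁻¹ = a⁻¹))
    (u : (↥D.K)ˣ) {n : ℕ} (hn : n ≠ 0) (hun : u ^ n = 1) (hu2 : u ^ 2 ≠ 1) : IsEmpty D.KummerData := by
  refine ⟨fun E => hu2 ?_⟩
  have hc : (E.kumY (E.toKHat u)) ^ n = 1 := by
    rw [← map_pow, ← map_pow, hun, map_one, map_one]
  have hc2 := D.h1Theta_pow_two_eq_one_of_conj_sign hO _ hsign _ hn hc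
  exact E.toKHat_injective (E.kumY_injective (by rw [map_pow, map_pow, hc2, map_one, map_one]))

/-- **Contrapositive: Kummer data force a NON-SIGN action on `Δ_Θ`.** If `K^×` has `u` with `uⁿ = 1`, `u² ≠ 1`, then at every
Kummer-carrying `D` some `g ∈ (Π^tp_Y)^Θ` acts on `Δ_Θ` neither trivially nor by inversion. [cite: MochizukiEtTh2009, Prop 1.5 p.23] -/
theorem exists_conj_not_sign_of_kummerData (hO : D.IsEtThOrigin) (u : (↥D.K)ˣ) {n : ℕ} (hn : n ≠ 0) (hun : u ^ n = 1)
    (hu2 : u ^ 2 ≠ 1) (E : D.KummerData) :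
    ∃ g ∈ D.GtpY.map D.toTheta,
      ¬ ((∀ a ∈ D.DeltaTheta, g * a * g⁻¹ = a) ∨ (∀ a ∈ D.DeltaTheta, g * a * g⁻¹ = a⁻¹)) := by
  by_contra h
  push Not at h
  exact (D.isEmpty_kummerData_of_conj_sign hO (fun g hg => h g hg) u hn hun hu2).false E

end ThetaSetting

/-! ## §3. `p ≥ 5`: a root of unity `ζ ∈ ℚ_p ⊆ K` with `ζ^{p−1} = 1`, `ζ² ≠ 1` (Hensel), and the unconditional form -/

section Hensel

open Polynomial

variable {p : ℕ} [Fact p.Prime]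

/-- **A `(p−1)`-th root of unity `ζ ∈ ℤ_p` with `ζ² ≠ 1`, for `p ≥ 5`** (Hensel's lemma for `X^{p−1} − 1` at a lift of a generator of
`(ℤ/p)^×`, whose order `p − 1 ≥ 4` exceeds `2`). [cite: Gouvea1993PadicNumbers, Prop. 4.6.1 (§4.6)] -/
theorem padicInt_exists_pow_pred_eq_one_sq_ne_one (hp : 5 ≤ p) : ∃ ζ : ℤ_[p], ζ ^ (p - 1) = 1 ∧ ζ ^ 2 ≠ 1 := by
  -- a generator of `(ℤ/p)^×`
  obtain ⟨g, hg⟩ := IsCyclic.exists_ofOrder_eq_natCard (α := (ZMod p)ˣ)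
  rw [Nat.card_eq_fintype_card, ZMod.card_units] at hg
  have hg2 : g ^ 2 ≠ 1 := pow_ne_one_of_lt_orderOf (by norm_num) (by rw [hg]; omega)
  have hgp : g ^ (p - 1) = 1 := ZMod.units_pow_card_sub_one_eq_one p g
  set r : ZMod p := (g : ZMod p) with hr
  have hr0 : r ≠ 0 := g.ne_zero
  have hrp : r ^ (p - 1) = 1 := by rw [hr, ← Units.val_pow_eq_pow_val, hgp, Units.val_one]
  have hr2 : r ^ 2 ≠ 1 := by
    intro h
    apply hg2
    exact Units.ext (by rw [Units.val_pow_eq_pow_val, ← hr, h, Units.val_one])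
  -- lift it to `ℤ_[p]`
  set a : ℤ_[p] := ((r.val : ℕ) : ℤ_[p]) with ha
  have har : PadicInt.toZMod a = r := by rw [ha, map_natCast, ZMod.natCast_zmod_val]
  set F : Polynomial ℤ_[p] := X ^ (p - 1) - 1 with hF
  have hFa : F.aeval a = a ^ (p - 1) - 1 := by simp [hF]
  have hF'a : F.derivative.aeval a = ((p - 1 : ℕ) : ℤ_[p]) * a ^ (p - 2) := by
    rw [hF]
    simp only [derivative_sub, derivative_X_pow, derivative_one, sub_zero, map_mul, map_pow, aeval_X, map_natCast]
    have : p - 1 - 1 = p - 2 := by omega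
    rw [this]
  have hsmall : ‖F.aeval a‖ < 1 := by
    rw [hFa, ← PadicInt.mem_nonunits, ← IsLocalRing.mem_maximalIdeal, ← PadicInt.ker_toZMod, RingHom.mem_ker, map_sub,
      map_pow, har, map_one, hrp, sub_self]
  have hp1 : ((p - 1 : ℕ) : ZMod p) ≠ 0 := by
    rw [Ne, ZMod.natCast_eq_zero_iff]
    intro h
    have := Nat.le_of_dvd (by omega) h
    omega
  have hunit : ‖F.derivative.aeval a‖ = 1 := by
    rw [hF'a]
    by_contra hne
    have hlt : ‖((p - 1 : ℕ) : ℤ_[p]) * a ^ (p - 2)‖ < 1 := lt_of_le_of_ne (PadicInt.norm_le_one _) hne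
    rw [← PadicInt.mem_nonunits, ← IsLocalRing.mem_maximalIdeal, ← PadicInt.ker_toZMod, RingHom.mem_ker, map_mul, map_pow,
      har, map_natCast] at hlt
    exact mul_ne_zero hp1 (pow_ne_zero _ hr0) hlt
  have hnorm : ‖F.aeval a‖ < ‖F.derivative.aeval a‖ ^ 2 := by rw [hunit, one_pow]; exact hsmall
  obtain ⟨z, hz, hza, -⟩ := hensels_lemma hnorm
  refine ⟨z, ?_, ?_⟩
  · have : z ^ (p - 1) - 1 = 0 := by simpa [hF] using hz
    exact sub_eq_zero.mp this
  · -- `z ≡ a ≡ r (mod p)` and `r² ≠ 1`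
    rw [hunit] at hza
    have hzr : PadicInt.toZMod z = r := by
      have hmem : z - a ∈ IsLocalRing.maximalIdeal ℤ_[p] := by
        rw [IsLocalRing.mem_maximalIdeal, PadicInt.mem_nonunits]; exact hza
      rw [← PadicInt.ker_toZMod, RingHom.mem_ker, map_sub, sub_eq_zero] at hmem
      rw [hmem, har]
    intro h
    apply hr2
    rw [← hzr, ← map_pow, h, map_one]

/-- **In `K^×` (`ℚ_p ⊆ K ⊆ ℚ̄_p`), for `p ≥ 5`, there is `u` with `u^{p−1} = 1` and `u² ≠ 1`.** [cite: Gouvea1993PadicNumbers, Prop. 4.6.1 (§4.6)] -/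
theorem ThetaSetting.exists_unit_pow_eq_one_sq_ne_one (D : ThetaSetting p) (hp : 5 ≤ p) :
    ∃ u : (↥D.K)ˣ, u ^ (p - 1) = 1 ∧ u ^ 2 ≠ 1 := by
  obtain ⟨ζ, hζ, hζ2⟩ := padicInt_exists_pow_pred_eq_one_sq_ne_one hp
  set w : D.K := algebraMap ℚ_[p] D.K (ζ : ℚ_[p]) with hw
  have hwpow : ∀ m : ℕ, w ^ m = algebraMap ℚ_[p] D.K ((ζ ^ m : ℤ_[p]) : ℚ_[p]) := fun m => by
    rw [hw, ← map_pow, PadicInt.coe_pow]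
  have hw1 : w ^ (p - 1) = 1 := by rw [hwpow, hζ, PadicInt.coe_one, map_one]
  have hw0 : w ≠ 0 := by
    intro h
    have h1 := hw1
    rw [h, zero_pow (by omega)] at h1
    exact zero_ne_one h1
  refine ⟨Units.mk0 w hw0, Units.ext ?_, fun h => hζ2 ?_⟩
  · rw [Units.val_pow_eq_pow_val, Units.val_mk0, hw1, Units.val_one]
  · have h' : w ^ 2 = 1 := by
      have := congrArg Units.val h
      rwa [Units.val_pow_eq_pow_val, Units.val_mk0, Units.val_one] at this
    rw [hwpow] at h'
    have h'' : ((ζ ^ 2 : ℤ_[p]) : ℚ_[p]) = 1 :=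
      (algebraMap ℚ_[p] D.K).injective (by rw [h', map_one])
    exact Subtype.ext (h''.trans PadicInt.coe_one.symm)

end Hensel

namespace ThetaSetting

variable {p : ℕ} [Fact p.Prime] (D : ThetaSetting p)

/-- **`p ≥ 5`: a theta setting whose `(Π^tp_Y)^Θ` acts on `Δ_Θ` through `{±1}` carries NO Kummer data.**
[cite: MochizukiEtTh2009, Prop 1.5 p.23] -/
theorem isEmpty_kummerData_of_conj_sign_of_five_le (hp : 5 ≤ p) (hO : D.IsEtThOrigin)
    (hsign : ∀ g ∈ D.GtpY.map D.toTheta,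
      (∀ a ∈ D.DeltaTheta, g * a * g⁻¹ = a) ∨ (∀ a ∈ D.DeltaTheta, g * a * g⁻¹ = a⁻¹)) : IsEmpty D.KummerData := by
  obtain ⟨u, hu, hu2⟩ := D.exists_unit_pow_eq_one_sq_ne_one hp
  exact D.isEmpty_kummerData_of_conj_sign hO hsign u (by omega) hu hu2

/-- **`p ≥ 5`: Kummer data force a non-sign action on `Δ_Θ`** — at every `D : ThetaSetting p` with the guard and `Nonempty KummerData`
some `g ∈ (Π^tp_Y)^Θ` acts on `Δ_Θ` neither trivially nor by inversion (abc-iut-L2-lead G-row G-L2t5-1: with a commutator-axis cusp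
this is a `u`-scaling of the cusp axis with `u ∉ {±1}`). [cite: MochizukiEtTh2009, Prop 1.5 p.23] -/
theorem exists_conj_not_sign_of_kummerData_of_five_le (hp : 5 ≤ p) (hO : D.IsEtThOrigin) (E : D.KummerData) :
    ∃ g ∈ D.GtpY.map D.toTheta,
      ¬ ((∀ a ∈ D.DeltaTheta, g * a * g⁻¹ = a) ∨ (∀ a ∈ D.DeltaTheta, g * a * g⁻¹ = a⁻¹)) := by
  obtain ⟨u, hu, hu2⟩ := D.exists_unit_pow_eq_one_sq_ne_one hp
  exact D.exists_conj_not_sign_of_kummerData hO u (by omega) hu hu2 E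

end ThetaSetting

end Literature.AnabelianGeometry.EtaleTheta

end
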